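import Mathlib
import Literature.Analysis.FluidPDE.TypeIICoreWitness
import Summits.NavierStokesRegularity.NavierStokesRegularity.Theorems.TypeIIInviscidRelaxationCoreExclusionAnchorObstruction
import HarnessLib

/-!
# Crux `ColumnarCoreExclusion` (stmt-1966): the anchor stub's residual — ANCHORING at the singular point is not
# kinematic either (a wandering core)

`--supports stmt-NavierStokesRegularity-1966` (helper file, negative side; theorems only, no definitions, no `sorry`).
Sequel to `…CoreExclusionAnchorObstruction` (p832090/p832161): there the explicit family had its core centred AT the
eventual singular point, so of the three extra conclusions of `stub_anchoredLateColumnarWitness` (lateness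
`(T-t)V ≤ KL`, a core-radius floor, anchoring `dist xs x₀ ≤ KL/4` at a singular `xs`) only lateness and the floor were
shown to be non-kinematic.  Here the core WANDERS: at time `t`, `s = 1 - t`, the same columnar cone core (length `s²`,
speed `s⁻³`, cut off at radius `s/3`) is centred at `c(t) = s·e_x`, which tends to the origin.  Then
(`CoreExclusionAnchorObstruction.exists_columnarWitnesses_unanchored`):
(i) `hw` holds verbatim — columnar witnesses at every level frequently before `T = 1`;
(ii) the origin is SINGULAR in the stub's sense (unbounded on every backward parabolic neighbourhood) and it is the
ONLY such point (every `x ≠ 0` has a bounded backward parabolic neighbourhood);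
(iii) for every `K > 4` and `0 < t < 1`, EVERY datum satisfying the near-maximum and level-`K` columnar-closeness
clauses is NOT anchored at the singular point — `dist 0 x₀ > K·L/4` — besides `K·L ≤ 1 - t` and non-lateness.
So all three extra conclusions of the anchor stub are properties of the Navier–Stokes dynamics, not of `hw`.
Nothing about Navier–Stokes is claimed; `u` is not a solution; no stub or crux is proved or refuted here.
-/

noncomputable section

open Set Metric Filter Topology
open Literature.Analysis Literature.Analysis.FluidPDE

namespace Summit.NavierStokesRegularity.NavierStokesRegularity.Theorems

-- the problem directory repeats the summit name (`NavierStokesRegularity/NavierStokesRegularity`)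
set_option linter.dupNamespace false

namespace CoreExclusionAnchorObstruction

/-- `‖e_z‖ = 1` (file-local copy). [folklore] -/
private theorem norm_eZ_w : ‖(eZ : EuclideanSpace ℝ (Fin 3))‖ = 1 := by
  simp [eZ]

/-- **A wandering columnar core: witnesses at every level, a unique singular point, and no witness anchored at it.**
See the module docstring. [folklore] -/
theorem exists_columnarWitnesses_unanchored :
    ∃ u : ℝ → EuclideanSpace ℝ (Fin 3) → EuclideanSpace ℝ (Fin 3),
      (∀ K : ℝ, 0 < K → ∀ t₀ < (1 : ℝ), ∃ t, t₀ < t ∧ t < 1 ∧ TypeIICoreWitness IsColumnar 1 K u t) ∧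
      (¬ ∃ ρ M : ℝ, 0 < ρ ∧ ∀ s ∈ Ioo (1 - ρ ^ 2) 1, ∀ x ∈ ball (0 : EuclideanSpace ℝ (Fin 3)) ρ,
        ‖u s x‖ ≤ M) ∧
      (∀ xr : EuclideanSpace ℝ (Fin 3), xr ≠ 0 → ∃ ρ M : ℝ, 0 < ρ ∧ ∀ s ∈ Ioo (1 - ρ ^ 2) 1,
        ∀ x ∈ ball xr ρ, ‖u s x‖ ≤ M) ∧
      (∀ (K t : ℝ), 4 < K → 0 < t → t < 1 →
        ∀ (x₀ : EuclideanSpace ℝ (Fin 3)) (L V : ℝ)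
          (Q : EuclideanSpace ℝ (Fin 3) ≃ₗᵢ[ℝ] EuclideanSpace ℝ (Fin 3))
          (W : EuclideanSpace ℝ (Fin 3) → EuclideanSpace ℝ (Fin 3)),
          0 < L → 0 < V → IsColumnar W → (∀ x, ‖u t x‖ ≤ V) →
          (∃ x₁, dist x₁ x₀ ≤ L ∧ V ≤ 2 * ‖u t x₁‖) →
          (∀ y : EuclideanSpace ℝ (Fin 3), ‖y‖ ≤ K →
            ‖V⁻¹ • Q.symm (u t (x₀ + L • Q y)) - W y‖ ≤ K⁻¹) →
          K * L ≤ 1 - t ∧ K * L < (1 - t) * V ∧ K * L / 4 < dist 0 x₀) := by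
  -- the profile, the wandering centre and the family
  set G : EuclideanSpace ℝ (Fin 3) → EuclideanSpace ℝ (Fin 3) :=
    fun y => max 0 (1 - cylRadius y) • (eZ : EuclideanSpace ℝ (Fin 3)) with hG
  set c : ℝ → EuclideanSpace ℝ (Fin 3) := fun t => (1 - t) • EuclideanSpace.single 0 1 with hc
  set u : ℝ → EuclideanSpace ℝ (Fin 3) → EuclideanSpace ℝ (Fin 3) :=
    fun t x => if ‖x - c t‖ ≤ (1 - t) / 3 then ((1 - t)⁻¹ ^ 3) • G (((1 - t) ^ 2)⁻¹ • (x - c t)) else 0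
    with hu
  have hGle : ∀ y, ‖G y‖ ≤ 1 := fun y => norm_coneProfile_le y
  have hG0 : G 0 = eZ := coneProfile_zero
  have hGcol : IsColumnar G := isColumnar_coneProfile
  have hnc : ∀ t < (1 : ℝ), ‖c t‖ = 1 - t := by
    intro t ht
    rw [hc]
    simp only [norm_smul, Real.norm_of_nonneg (sub_pos.2 ht).le]
    simp
  -- value at the centre and the global speed bound
  have huc : ∀ t < (1 : ℝ), u t (c t) = ((1 - t)⁻¹ ^ 3) • (eZ : EuclideanSpace ℝ (Fin 3)) := by
    intro t ht
    have h : ‖c t - c t‖ ≤ (1 - t) / 3 := by rw [sub_self, norm_zero]; linarith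
    simp only [hu, if_pos h, sub_self, smul_zero, hG0]
  have hnormc : ∀ t < (1 : ℝ), ‖u t (c t)‖ = (1 - t)⁻¹ ^ 3 := by
    intro t ht
    rw [huc t ht, norm_smul, norm_eZ_w, mul_one, Real.norm_of_nonneg (by positivity)]
  have hbound : ∀ t < (1 : ℝ), ∀ x, ‖u t x‖ ≤ (1 - t)⁻¹ ^ 3 := by
    intro t ht x
    by_cases hx : ‖x - c t‖ ≤ (1 - t) / 3
    · simp only [hu, if_pos hx]
      rw [norm_smul, Real.norm_of_nonneg (by positivity)]
      exact mul_le_of_le_one_right (by positivity) (hGle _)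
    · simp only [hu, if_neg hx, norm_zero]
      positivity
  have hsupp : ∀ t x, u t x ≠ 0 → dist x (c t) ≤ (1 - t) / 3 := by
    intro t x hx
    rw [dist_eq_norm]
    by_contra h
    exact hx (by simp only [hu, if_neg h])
  have hzero : ∀ t x, (1 - t) / 3 < dist x (c t) → u t x = 0 := by
    intro t x hx
    by_contra h
    exact absurd (hsupp t x h) (not_le.2 hx)
  -- exact columnarity on the core ball around the centre
  have hcore : ∀ t < (1 : ℝ), ∀ y : EuclideanSpace ℝ (Fin 3), ‖y‖ * (1 - t) ≤ 3⁻¹ →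
      u t (c t + ((1 - t) ^ 2) • (LinearIsometryEquiv.refl ℝ _ y)) = ((1 - t)⁻¹ ^ 3) • G y := by
    intro t ht y hy
    have hs : 0 < 1 - t := sub_pos.2 ht
    have hn : ‖c t + ((1 - t) ^ 2) • y - c t‖ ≤ (1 - t) / 3 := by
      rw [add_sub_cancel_left, norm_smul, Real.norm_of_nonneg (by positivity)]
      nlinarith
    simp only [LinearIsometryEquiv.coe_refl, id_eq]
    simp only [hu, if_pos hn, add_sub_cancel_left, smul_smul, inv_mul_cancel₀ (pow_ne_zero 2 hs.ne'), one_smul]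
  refine ⟨u, ?_, ?_, ?_, ?_⟩
  · -- (i) witnesses at every level frequently before `1`, centred at the wandering centre
    intro K hK t₀ ht₀
    set t : ℝ := (max t₀ (1 - (6 * K)⁻¹) + 1) / 2 with ht
    have hK6 : 0 < (6 * K)⁻¹ := by positivity
    have hmax_lt : max t₀ (1 - (6 * K)⁻¹) < 1 := max_lt ht₀ (by linarith)
    have ht₀t : t₀ < t := by
      have := le_max_left t₀ (1 - (6 * K)⁻¹); rw [ht]; linarith
    have ht1 : t < 1 := by rw [ht]; linarith
    have hs : 0 < 1 - t := sub_pos.2 ht1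
    have hsK : (1 - t) ≤ (6 * K)⁻¹ := by
      have := le_max_right t₀ (1 - (6 * K)⁻¹); rw [ht]; linarith
    have hsK' : (1 - t) * K ≤ 6⁻¹ := by
      calc (1 - t) * K ≤ (6 * K)⁻¹ * K := mul_le_mul_of_nonneg_right hsK hK.le
        _ = 6⁻¹ := by field_simp
    refine ⟨t, ht₀t, ht1, c t, (1 - t) ^ 2, (1 - t)⁻¹ ^ 3, LinearIsometryEquiv.refl ℝ _, G,
      by positivity, by positivity, hGcol, hbound t ht1, ?_, ?_, ?_, ?_⟩
    · refine ⟨c t, by rw [dist_self]; positivity, ?_⟩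
      rw [hnormc t ht1]; linarith [pow_pos (inv_pos.2 hs) 3]
    · refine ⟨0, EuclideanSpace.single 0 1, by simp, by simp, ?_⟩
      have hG1 : G (EuclideanSpace.single 0 1) = 0 := coneProfile_single_zero
      rw [hG0, hG1, sub_zero, norm_eZ_w]
      norm_num
    · have h1 : (1 - t) ^ 2 * (1 - t)⁻¹ ^ 3 = (1 - t)⁻¹ := by field_simp
      rw [mul_one, h1, le_inv_comm₀ hK hs]
      exact hsK.trans (inv_anti₀ hK (by linarith))
    · intro y hy
      have hy' : ‖y‖ * (1 - t) ≤ 3⁻¹ := by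
        calc ‖y‖ * (1 - t) ≤ K * (1 - t) := mul_le_mul_of_nonneg_right hy hs.le
          _ = (1 - t) * K := mul_comm _ _
          _ ≤ 6⁻¹ := hsK'
          _ ≤ 3⁻¹ := by norm_num
      have hrefl : ∀ z : EuclideanSpace ℝ (Fin 3),
          (LinearIsometryEquiv.refl ℝ (EuclideanSpace ℝ (Fin 3))).symm z = z := fun z => rfl
      rw [hcore t ht1 y hy', hrefl, smul_smul,
        inv_mul_cancel₀ (by positivity : (1 - t)⁻¹ ^ 3 ≠ 0), one_smul, sub_self, norm_zero]
      positivity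
  · -- (ii) the origin is singular: the centre `c(t) → 0` carries speed `(1-t)⁻³ → ∞`
    rintro ⟨ρ, M, hρ, hbd⟩
    set σ : ℝ := min (min (ρ ^ 2 / 2) (ρ / 2)) (|M| + 2)⁻¹ with hσ
    have hM2 : 0 < |M| + 2 := by positivity
    have hσ0 : 0 < σ := lt_min (lt_min (by positivity) (by positivity)) (inv_pos.2 hM2)
    have hσ1 : σ ≤ ρ ^ 2 / 2 := (min_le_left _ _).trans (min_le_left _ _)
    have hσ2 : σ ≤ ρ / 2 := (min_le_left _ _).trans (min_le_right _ _)
    have hσ3 : σ ≤ (|M| + 2)⁻¹ := min_le_right _ _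
    have hσle1 : σ ≤ 1 := hσ3.trans (inv_le_one_of_one_le₀ (by linarith [abs_nonneg M]))
    have hmem : 1 - σ ∈ Ioo (1 - ρ ^ 2) 1 := ⟨by linarith, by linarith⟩
    have hcmem : c (1 - σ) ∈ ball (0 : EuclideanSpace ℝ (Fin 3)) ρ := by
      rw [mem_ball, dist_zero_right, hnc (1 - σ) (by linarith), sub_sub_cancel]
      linarith
    have h := hbd (1 - σ) hmem (c (1 - σ)) hcmem
    rw [hnormc (1 - σ) (by linarith), sub_sub_cancel] at h
    have h4 : |M| + 2 ≤ σ⁻¹ := by rw [le_inv_comm₀ hM2 hσ0]; exact hσ3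
    have h5 : σ⁻¹ ≤ σ⁻¹ ^ 3 := by
      have h6 : (1 : ℝ) ≤ σ⁻¹ := one_le_inv_iff₀.2 ⟨hσ0, hσle1⟩
      calc σ⁻¹ = σ⁻¹ ^ 1 := (pow_one _).symm
        _ ≤ σ⁻¹ ^ 3 := pow_le_pow_right₀ h6 (by norm_num)
    linarith [le_abs_self M]
  · -- (ii') every other point is regular
    intro xr hxr
    have hxr0 : 0 < ‖xr‖ := norm_pos_iff.2 hxr
    refine ⟨‖xr‖ / 4, (‖xr‖ / 4)⁻¹ ^ 3, by positivity, fun s' hs' x hx => ?_⟩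
    have hs'1 : s' < 1 := hs'.2
    set σ : ℝ := 1 - s' with hσ
    have hσ0 : 0 < σ := sub_pos.2 hs'1
    by_cases hσx : σ < ‖xr‖ / 4
    · -- the core is far from `x`: `u s' x = 0`
      have hfar : (1 - s') / 3 < dist x (c s') := by
        rw [mem_ball] at hx
        have h1 : ‖xr‖ ≤ dist x (c s') + dist x xr + ‖c s'‖ := by
          have h2 : dist xr (c s') ≤ dist xr x + dist x (c s') := dist_triangle _ _ _
          have h3 : ‖xr‖ ≤ dist xr (c s') + ‖c s'‖ := by
            rw [dist_eq_norm]
            calc ‖xr‖ = ‖(xr - c s') + c s'‖ := by rw [sub_add_cancel]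
              _ ≤ ‖xr - c s'‖ + ‖c s'‖ := norm_add_le _ _
          rw [dist_comm xr x] at h2
          linarith
        rw [hnc s' hs'1] at h1
        rw [← hσ] at h1 ⊢
        linarith
      rw [hzero s' x hfar, norm_zero]
      positivity
    · -- the core may be close, but its speed is at most `σ⁻³ ≤ (‖xr‖/4)⁻³`
      push Not at hσx
      refine (hbound s' hs'1 x).trans ?_
      rw [← hσ]
      exact pow_le_pow_left₀ (by positivity) (inv_anti₀ (by positivity) hσx) 3
  · -- (iii) no floor, never late, never anchored at the singular point
    intro K t hK ht0 ht1 x₀ L V Q W hL hV hW hbd hnear hclose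
    have hs : 0 < 1 - t := sub_pos.2 ht1
    have hs1 : 1 - t < 1 := by linarith
    have hLK : L * (K - 1) ≤ 2 * ((1 - t) / 3) :=
      mul_sub_one_le_of_support (hsupp t) hK hL hV hW hnear hclose
    have hKL : K * L < 3 * ((1 - t) / 3) :=
      coreRadius_lt_of_support (hsupp t) hK hL hV hW hnear hclose
    have hV' : (1 - t)⁻¹ ^ 3 ≤ V := by rw [← hnormc t ht1]; exact hbd (c t)
    have h1 : (1 : ℝ) ≤ (1 - t)⁻¹ ^ 3 := one_le_pow₀ (one_le_inv_iff₀.2 ⟨hs, hs1.le⟩)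
    have h2 : (1 - t) * 1 ≤ (1 - t) * V := mul_le_mul_of_nonneg_left (h1.trans hV') hs.le
    refine ⟨by linarith, by linarith, ?_⟩
    -- anchoring fails: the centre is at distance `1 - t` from the origin, the core has radius `(1-t)/3`
    obtain ⟨x₁, hx₁, hVx₁⟩ := hnear
    have hfx₁ : u t x₁ ≠ 0 := by
      intro h
      rw [h, norm_zero, mul_zero] at hVx₁
      exact absurd hVx₁ (not_le.2 hV)
    have hx₁c : dist x₁ (c t) ≤ (1 - t) / 3 := hsupp t x₁ hfx₁
    have hL9 : L < (1 - t) / 4 := by nlinarith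
    have htri : 1 - t ≤ dist 0 x₀ + L + (1 - t) / 3 := by
      have h3 : dist (0 : EuclideanSpace ℝ (Fin 3)) (c t) = 1 - t := by rw [dist_comm, dist_zero_right, hnc t ht1]
      have h4 := dist_triangle (0 : EuclideanSpace ℝ (Fin 3)) x₀ (c t)
      have h5 := dist_triangle x₀ x₁ (c t)
      rw [dist_comm x₀ x₁] at h5
      linarith
    linarith

end CoreExclusionAnchorObstruction

end Summit.NavierStokesRegularity.NavierStokesRegularity.Theorems

end
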